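import Summits.PneNP.PneNP.Theses.ORIncompressibility
import Literature.Computability.Complexity.ClayProblem
import Literature.Computability.Complexity.ClayProblemProofs

/-!
# Route ORIncompressibility — `Assembly` (stmt-PneNP-0992)

`Assembly := OneBitCompressorOfNPSubsetP → NoORCompression → PneNP`. If Cook's `PneNP` failed, the proved model bridges
give `NP ⊆ P`, hence (first hypothesis) a one-bit OR-SAT compressor `f ∈ FP`; `NoORCompression` at `a := 1` then
produces, for some `n ≥ 1`, tuples `xs`, `ys` with either `|f ⟨xs⟩| > n ≥ 1` (but `f` outputs one bit) or
`f ⟨xs⟩ = f ⟨ys⟩` with different OR-SAT values (but the bit IS the OR-SAT value). Propositional over the two items.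
-/

set_option linter.dupNamespace false -- `Summit.PneNP.PneNP.…`: summit = sub-problem name (D-0017 single-conjunct layout)

namespace Summit.PneNP.PneNP.Theorems

open Filter
open Literature.Computability.Complexity

/-- **Assembly item of route ORIncompressibility (stmt-PneNP-0992)**: `OneBitCompressorOfNPSubsetP → NoORCompression →
PneNP` — a one-bit OR-SAT compressor (from `NP ⊆ P`) is refuted by `NoORCompression` at exponent `a = 1`.
[cite: FortnowSanthanam2011, §1] [folklore] -/
theorem orIncompressibility_assembly_proof : Summit.PneNP.PneNP.Theses.ORIncompressibility.Assembly := by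
  unfold Summit.PneNP.PneNP.Theses.ORIncompressibility.Assembly
    Summit.PneNP.PneNP.Theses.ORIncompressibility.OneBitCompressorOfNPSubsetP
    Summit.PneNP.PneNP.Theses.ORIncompressibility.NoORCompression
  intro hOne hNo
  by_contra hcon
  have hP : PNPWave0.P Bool = Classes.P := P_bool_eq_holds
  have hN : PNPWave0.NP Bool = Nondeterministic.NP := NP_bool_eq_holds
  have hsub : Nondeterministic.NP ⊆ Classes.P := by
    intro L hL
    by_contra hLP
    exact hcon ⟨L, hN ▸ hL, hP ▸ hLP⟩
  obtain ⟨f, hf, hspec⟩ := hOne hsub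
  obtain ⟨c, hc⟩ := hNo 1
  obtain ⟨n, ⟨xs, ys, -, -, hor⟩, hn⟩ := ((hc f hf).and_eventually (eventually_ge_atTop 1)).exists
  obtain ⟨b, hb, hbiff⟩ := hspec xs
  obtain ⟨b', hb', hbiff'⟩ := hspec ys
  rcases hor with hlen | ⟨heq, hne⟩
  · rw [hb, List.length_singleton, pow_one] at hlen
    omega
  · apply hne
    rw [hb, hb'] at heq
    have hbb : b = b' := by simpa using heq
    rw [← hbiff, ← hbiff', hbb]

end Summit.PneNP.PneNP.Theorems
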